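import Literature.NumberTheory.Sieve.Maynard2016Prop92MainDecomposition
import Literature.NumberTheory.Sieve.Maynard2016Prop92EDiff
import HarnessLib

/-!
# [Maynard2016DenseClusters, Prop. 9.2 — the main part of the proof (pp. 21–23)] for `𝒜 = ℤ` — DISCHARGED:
# `maynard2016Prop92MainPart_holds`

Kernel-lane companion of ★ `Literature/NumberTheory/Sieve/Maynard2016Prop92Decomposition.lean`: its named fact
★ `Maynard2016Prop92MainPart` (in the frame of [FordGreenKonyaginMaynardTao2018, Thm 6]: for every form `L_m` with `(a_m, B) = 1`,
`φ_ω(W)/φ_{L_m}(W) · Q_m = (1 + O(log^{−1/10} X)) · mainCoeffB`) is PROVED here by composing tree theorems — the assembly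
★ `maynard2016Prop92MainPart_of_leaves : Maynard2016Prop92Regroup → Maynard2016Prop92EDiffBound → Maynard2016Prop92YSqSum →
Maynard2016Prop92MainPart` (`Maynard2016Prop92MainDecomposition.lean`) fed with the three proved leaves
★ `maynard2016Prop92Regroup_holds` (M1, `Maynard2016Prop92Regroup.lean`), ★ `maynard2016Prop92EDiffBound_holds` (M3) and
★ `maynard2016Prop92YSqSum_holds` (M4, both `Maynard2016Prop92EDiff.lean`, from Lemma 9.3 proved in the tree).  The composite had not
been written down, so the fact still counted as unproved.  THEOREMS ONLY (no definition, no named fact, no `sorry`, no instance, no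
notation); seat B-typ01 (g33) of cell hodgecm-mathlib (off-rota Literature discharges); net debt −1.

## References
* [Maynard2016DenseClusters] J. Maynard, *Dense clusters of primes in subsets*, Compositio Math. 152 (2016), Prop. 9.2 (proof pp. 21–23,
  displays (9.9)–(9.22)), Lemma 9.3 (pp. 23–24).
* [FordGreenKonyaginMaynardTao2018] K. Ford, B. Green, S. Konyagin, J. Maynard, T. Tao, *Long gaps between primes*, JAMS 31 (2018),
  Thm 6 (7.13) p. 21.
-/

namespace Literature.NumberTheory.Sieve

/-- ★ `Maynard2016Prop92MainPart` HOLDS ([Maynard2016DenseClusters, Prop. 9.2, main part of the proof, pp. 21–23] for `𝒜 = ℤ`): the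
assembly ★ `maynard2016Prop92MainPart_of_leaves` applied to the proved leaves M1 (regrouping, ★ `maynard2016Prop92Regroup_holds`), M3
(the `y^{(m)}_s − y^{(m)}_r` terms, ★ `maynard2016Prop92EDiffBound_holds`) and M4 (the `y^{(m)}`-square sum,
★ `maynard2016Prop92YSqSum_holds`). [cite: Maynard2016DenseClusters, Prop. 9.2 proof pp. 21–23 ((9.9)–(9.22)) and Lemma 9.3 pp. 23–24] [cite: FordGreenKonyaginMaynardTao2018, Thm 6 (7.13) p. 21] -/
theorem maynard2016Prop92MainPart_holds : Maynard2016Prop92MainPart :=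
  maynard2016Prop92MainPart_of_leaves maynard2016Prop92Regroup_holds maynard2016Prop92EDiffBound_holds
    maynard2016Prop92YSqSum_holds

end Literature.NumberTheory.Sieve
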